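import Literature.Claims.NS.Kovacevic2016
import HarnessLib

/-!
# C114 `Kovacevic2016` — kernel certificate for the NS-claims sweep (D-0090), refuter-8

Typed record: `Literature.Claims.NS.Kovacevic2016` (typist-1 g2, p480245), D. Kovacevic, arXiv 1608.04975
v1, Theorem 1.1 p.3 read with the Introduction p.1 and (1.196) p.24: for the prescribed, time-frozen
field `u` and the force `f(x,t) = (0, 0, 1/(1 + t²(x₁+x₂+x₃)²))` the momentum equation admits no pressure
at `t = 0`.

Kernel facts (sorry-free, standard axioms):

* `not_hasRapidSpaceTimeDecay_force` — the printed force is not of Fefferman's class (5): `f(·,0) ≡ e₃`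
  has norm `1` at every `x`, so `(1 + |x| + t)·|f| ≤ C` fails already for `n = 0`, `K = 1`, `t = 0`.
* `not_hasRapidSpatialDecay_uField` — the printed datum is not of Fefferman's class (4): along the
  `x₁`-axis `u₂(r e₁) = 2r/(1+r²)²`, so `(1 + |x|)⁴·|u| ≥ 2r` is unbounded (`n = 0`, `K = 4`).
* `not_ClayDelta` (`'`) — hence the typed bridging hypothesis `ClayDelta` (Δ4 ∧ Δ3 ∧ Δ6) to Clay (C) is
  false as stated: the identification «Theorem 1.1 = an instance of (C)» is not available (Δ3 and Δ4
  certificates).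
* `tendsto_arctan_mul_div` / `not_Indeterminate208` — erratum column: (1.207)–(1.208) p.26 call
  `ArcTan(t s)/t` at `t = 0` «0/0 … cannot be determined»; the limit exists and equals `s`.

WHAT THIS IS NOT: not a claim about NS regularity or blow-up; not a claim about any author beyond the
typed locator.
-/

set_option linter.dupNamespace false

noncomputable section

open Set Filter Topology
open Literature.Analysis.FluidPDE
open Literature.Claims.NS.Kovacevic2016 (E3 force uField sFun dVec)

namespace Summit.NavierStokesRegularity.NavierStokesRegularity.Theorems.Kovacevic2016

/-! ## Δ3: the force at `t = 0` -/

/-- At `t = 0` the printed force is the constant unit vector `e₃`. [folklore] -/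
theorem force_zero (x : E3) : force 0 x = EuclideanSpace.single (2 : Fin 3) (1 : ℝ) := by
  simp [force]

/-- **The printed force is not of Fefferman's class (5) (C114, Δ3 certificate).** With `n = 0`, `K = 1`,
`t = 0` the decay bound reads `(1 + |x|)·|e₃| ≤ C` for all `x`, false at `x = (|C| + 1)e₁`. [folklore] -/
theorem not_hasRapidSpaceTimeDecay_force : ¬ HasRapidSpaceTimeDecay force := by
  intro h
  obtain ⟨C, hC⟩ := h 0 1
  have hx := hC 0 le_rfl (EuclideanSpace.single (0 : Fin 3) (|C| + 1))
  rw [norm_iteratedFDerivWithin_zero, Function.uncurry_apply_pair, force_zero,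
    PiLp.norm_single, PiLp.norm_single, norm_one, mul_one, pow_one, add_zero,
    Real.norm_eq_abs, abs_of_nonneg (by positivity : (0 : ℝ) ≤ |C| + 1)] at hx
  have : C ≤ |C| := le_abs_self C
  linarith

/-! ## Δ4: the datum along the `x₁`-axis -/

/-- Along the `x₁`-axis the second component of the printed field is `u₂(r e₁) = 2r/(1+r²)²`.
[folklore] -/
theorem uField_axis_one (r : ℝ) :
    uField (EuclideanSpace.single (0 : Fin 3) r) 1 = 2 / (1 + r ^ 2) ^ 2 * r := by
  simp [uField, sFun, dVec]

/-- **The printed datum is not of Fefferman's class (4) (C114, Δ4 certificate).** With `n = 0`, `K = 4`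
the decay bound along the `x₁`-axis gives `(1 + r)⁴ · 2r/(1+r²)² ≤ C`, whose left side is `≥ 2r`
(`|u| ~ 2√2/|x|³` at infinity, slower than `(1+|x|)⁻⁴`). [folklore] -/
theorem not_hasRapidSpatialDecay_uField : ¬ HasRapidSpatialDecay uField := by
  intro h
  obtain ⟨C, hC⟩ := h 0 4
  set r : ℝ := |C| + 1 with hr
  have hr0 : 0 ≤ r := by positivity
  have hx := hC (EuclideanSpace.single (0 : Fin 3) r)
  rw [norm_iteratedFDeriv_zero, PiLp.norm_single, Real.norm_eq_abs, abs_of_nonneg hr0] at hx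
  -- lower bound of the norm by the second coordinate
  have hcoord : 2 / (1 + r ^ 2) ^ 2 * r ≤ ‖uField (EuclideanSpace.single (0 : Fin 3) r)‖ := by
    have h1 := PiLp.norm_apply_le (uField (EuclideanSpace.single (0 : Fin 3) r)) 1
    rw [uField_axis_one, Real.norm_eq_abs, abs_of_nonneg (by positivity)] at h1
    exact h1
  have hkey : 2 * r ≤ (1 + r) ^ 4 * (2 / (1 + r ^ 2) ^ 2 * r) := by
    have hq : (1 + r ^ 2) ^ 2 ≤ (1 + r) ^ 4 := by nlinarith
    have hpos : 0 < (1 + r ^ 2) ^ 2 := by positivity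
    rw [div_mul_eq_mul_div, ← mul_div_assoc, le_div_iff₀ hpos]
    nlinarith
  have hle : (1 + r) ^ 4 * (2 / (1 + r ^ 2) ^ 2 * r) ≤
      (1 + r) ^ 4 * ‖uField (EuclideanSpace.single (0 : Fin 3) r)‖ :=
    mul_le_mul_of_nonneg_left hcoord (by positivity)
  have : C ≤ |C| := le_abs_self C
  linarith

/-- **The typed Clay bridge `ClayDelta` is false as stated (C114).** Its Δ4 and Δ3 conjuncts fail by
`not_hasRapidSpatialDecay_uField` and `not_hasRapidSpaceTimeDecay_force`; so
`clayC_of_claimed_of_delta` cannot be fed, and Theorem 1.1 (a pressure-compatibility statement for a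
frozen velocity with a non-decaying force and a slowly decaying datum) is not an instance of Clay (C).
[refuted-misstated relative to (C): the repaired reading is the Cauchy problem from `(u, f)`, whose first
unproved step is (1.196) p.24.] [folklore] -/
theorem not_ClayDelta : ¬ Literature.Claims.NS.Kovacevic2016.ClayDelta :=
  fun h => not_hasRapidSpaceTimeDecay_force h.2.1

/-- The same certificate through the Δ4 conjunct. [folklore] -/
theorem not_ClayDelta' : ¬ Literature.Claims.NS.Kovacevic2016.ClayDelta :=
  fun h => not_hasRapidSpatialDecay_uField h.1

/-! ## Erratum: (1.207)–(1.208) p.26 -/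

/-- `arctan(t s)/t → s` as `t → 0`, `t ≠ 0` (the derivative of `t ↦ arctan (t s)` at `0`). [folklore] -/
theorem tendsto_arctan_mul_div (s : ℝ) :
    Tendsto (fun t : ℝ => Real.arctan (t * s) / t) (𝓝[≠] 0) (𝓝 s) := by
  have hd : HasDerivAt (fun t : ℝ => Real.arctan (t * s)) s 0 := by
    have h1 : HasDerivAt (fun t : ℝ => t * s) s 0 := by
      simpa using (hasDerivAt_id (0 : ℝ)).mul_const s
    simpa using h1.arctan
  have ht := hd.tendsto_slope_zero
  refine ht.congr' (Eventually.of_forall fun t => ?_)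
  simp [smul_eq_mul, div_eq_inv_mul]

/-- **(1.208) p.26 as typed is false (C114, erratum column):** the quotient `arctan(t s)/t` has the limit
`s` at `t = 0`; e.g. `s = 1`. Not consumed by the composition `claim_of_steps`. [folklore] -/
theorem not_Indeterminate208 : ¬ Literature.Claims.NS.Kovacevic2016.Indeterminate208 :=
  fun h => h 1 ⟨1, tendsto_arctan_mul_div 1⟩

end Summit.NavierStokesRegularity.NavierStokesRegularity.Theorems.Kovacevic2016

end
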